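import Mathlib
import Literature.MathematicalPhysics.StatisticalMechanics.Crystallization
import Literature.MathematicalPhysics.StatisticalMechanics.BarlowStacking
import Literature.MathematicalPhysics.StatisticalMechanics.HaggStacking
import Literature.Geometry.DiscreteGeometry.KissingPatterns

/-!
# Sketch — crux stmt-AtomisticToContinuum-13603 (`ReggeStarCoercivity.DefectFreeCrystallizes`), ideator 1, round 1

First lemmas of the two idea cards (they need not be proved; they must elaborate):

* `DefectFreeLayered` — card `own-word-squeeze`: the crux's antecedent (zero density of 1/20-defective
  6/5-shells along a ground-state sequence `x`) implies LAYERED WINDOWS for that same `x`, in the exact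
  format of `HullMinimality.LayeredWindows` (stmt-11778 / PhononSlackCertificates), so that the cone's
  `PeriodicGivenLayered` (stmt-11779) and `HullCriterion` (stmt-3243) finish `IsCrystallizing lennardJones 3`.
* `PrestressSplit` — card `prestress-split-korn`: the exact energy identity about an equilibrium reference
  `y` for a pair energy written in squared distances, `V r = W (r^2)`: with bond weights `ω i j` that are
  symmetric and balance at every site of `y`, the energy difference is (tilted wells) + (stress form), the
  linear term telescoping to zero.
-/

noncomputable section

open scoped BigOperators RealInnerProductSpace
open Filter Topology

namespace Summit.AtomisticToContinuum.Crystallization.Cruxes.DefectFreeCrystallizes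

open Literature.MathematicalPhysics.StatisticalMechanics Literature.Geometry.DiscreteGeometry

local notation "E3" => EuclideanSpace ℝ (Fin 3)

/-- Number of 1/20-defective sites of a finite configuration — VERBATIM the sub-expression of the crux
`ReggeStarCoercivity.DefectFreeCrystallizes` / `ZeroDefectDensity` (shell = other particles within 6/5,
recentred, rescaled by `a⁻¹`, `a ∈ [9/10, 11/10]`, 1/20-matched after a linear isometry to the fcc or hcp
kissing pattern). -/
def defectCard (N : ℕ) (y : Fin N → E3) : ℕ :=
  Nat.card {i : Fin N // ¬ ∃ a : ℝ, 9 / 10 ≤ a ∧ a ≤ 11 / 10 ∧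
    (ShellCloseTo (1 / 20) ((Finset.univ.filter fun j : Fin N => j ≠ i ∧ dist (y i) (y j) ≤ 6 / 5).image
        fun j => a⁻¹ • (y j - y i)) fccKissingPattern ∨
      ShellCloseTo (1 / 20) ((Finset.univ.filter fun j : Fin N => j ≠ i ∧ dist (y i) (y j) ≤ 6 / 5).image
        fun j => a⁻¹ • (y j - y i)) hcpKissingPattern)}

/-- **Card `own-word-squeeze`, first lemma (DefectFreeLayered).** For every sequence of Lennard-Jones
ground states whose 1/20-defect fraction tends to `0` (the crux's antecedent, read per sequence), there
is an in-layer spacing `a ∈ [47/50, 1]` such that for every radius `R` and tolerance `ε > 0`, frequently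
in `N`, some rigid motion of `x N` is two-way `ε`-matched on `‖·‖ ≤ R` with a stack of triangular layers
of spacing `a` in hole registry along a Hägg word `s`, with FREE interlayer spacings
`z (m+1) - z m ∈ [39a/50, 17a/20]` — the format of `LayeredWindows` (stmt-11778; retired alias 3241). Intended proof: hull of
defect-free windows + robust template + stacking-blind coercivity against the relaxed Barlow equilibrium
OF THE CONFIGURATION'S OWN WORD + cut-and-paste cap `e_∞ ≤ e_per` + maximal-function exactification. -/
def DefectFreeLayered : Prop :=
  ∀ x : (N : ℕ) → (Fin N → E3), (∀ N, IsGroundState lennardJones (x N)) →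
    Tendsto (fun N : ℕ => (defectCard N (x N) : ℝ) / N) atTop (𝓝 0) →
    ∃ a : ℝ, 47 / 50 ≤ a ∧ a ≤ 1 ∧ ∀ R ε : ℝ, 0 < ε → ∃ᶠ N in atTop,
      ∃ (A : E3 →ₗᵢ[ℝ] E3) (t : E3) (s : ℤ → ℤ) (z : ℤ → ℝ), IsHaggSeq s ∧
        (∀ m : ℤ, 39 / 50 * a ≤ z (m + 1) - z m ∧ z (m + 1) - z m ≤ 17 / 20 * a) ∧
        let S : Set E3 := {p | ∃ m i j : ℤ, p = A (((i : ℝ) • triangularVec₁ a) +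
            ((j : ℝ) • triangularVec₂ a) + ((haggLabel s m : ℝ) • barlowOffset a) + (z m • layerNormal 1))}
        (∀ p ∈ S, ‖p‖ ≤ R → ∃ i : Fin N, dist (x N i + t) p ≤ ε) ∧
          (∀ i : Fin N, ‖x N i + t‖ ≤ R → ∃ p ∈ S, dist (x N i + t) p ≤ ε)

/-- Sanity: the crux's antecedent, read for ONE sequence, is literally the hypothesis shape above
(the crux quantifies it over all sequences first). -/
example (x : (N : ℕ) → (Fin N → E3)) :
    (Tendsto (fun N : ℕ => (defectCard N (x N) : ℝ) / N) atTop (𝓝 0)) =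
    (Tendsto (fun N : ℕ => (Nat.card {i : Fin N // ¬ ∃ a : ℝ, 9 / 10 ≤ a ∧ a ≤ 11 / 10 ∧
      (ShellCloseTo (1 / 20) ((Finset.univ.filter fun j : Fin N => j ≠ i ∧ dist (x N i) (x N j) ≤ 6 / 5).image
        fun j => a⁻¹ • (x N j - x N i)) fccKissingPattern ∨
      ShellCloseTo (1 / 20) ((Finset.univ.filter fun j : Fin N => j ≠ i ∧ dist (x N i) (x N j) ≤ 6 / 5).image
        fun j => a⁻¹ • (x N j - x N i)) hcpKissingPattern)} : ℝ) / N) atTop (𝓝 0)) := rfl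

/-- Pair energy of a finite configuration written through squared distances, `V r = W (r ^ 2)`
(for Lennard-Jones `W s = s⁻⁶/12 - s⁻³/6`). -/
def sqEnergy (W : ℝ → ℝ) {N : ℕ} (x : Fin N → E3) : ℝ :=
  ∑ i, ∑ j ∈ Finset.Ioi i, W (‖x j - x i‖ ^ 2)

/-- **Card `prestress-split-korn`, first lemma (PrestressSplit).** Exact identity about an equilibrium
reference: if the bond weights `ω` are symmetric and balance at every site of `y`
(`∑_{j ≠ i} ω i j • (y j - y i) = 0`, i.e. `y` is a critical point of `sqEnergy W` when
`ω i j = W' (‖y j - y i‖²)`), then for EVERY configuration `x`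
`E(x) - E(y) = Σ_{i<j} [W̃ᵢⱼ(sˣᵢⱼ) - W̃ᵢⱼ(sʸᵢⱼ)] + Σ_{i<j} ω i j ‖(x j - x i) - (y j - y i)‖²`,
`W̃ᵢⱼ(s) = W s - ω i j * s` (tilted wells, convex for Lennard-Jones first-shell bonds while
`‖x j - x i‖ < (7/4)^(1/6) ≈ 1.098`), the second sum being the STRESS FORM of the reference (weights
`ω < 0` on the compressed first shell, `ω > 0` on every farther bond for Lennard-Jones at `a* ≈ 0.971`);
the linear term `2 Σ ω ⟪y j - y i, δ⟫` telescopes to `-Σ_i ⟪F_i, x i - y i⟫ = 0`. No Taylor expansion of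
`W` is involved. -/
def PrestressSplit : Prop :=
  ∀ (N : ℕ) (W : ℝ → ℝ) (ω : Fin N → Fin N → ℝ) (x y : Fin N → E3),
    (∀ i j, ω i j = ω j i) →
    (∀ i, ∑ j ∈ Finset.univ.erase i, ω i j • (y j - y i) = 0) →
    sqEnergy W x - sqEnergy W y =
      (∑ i, ∑ j ∈ Finset.Ioi i,
        ((W (‖x j - x i‖ ^ 2) - ω i j * ‖x j - x i‖ ^ 2) - (W (‖y j - y i‖ ^ 2) - ω i j * ‖y j - y i‖ ^ 2))) +
      ∑ i, ∑ j ∈ Finset.Ioi i, ω i j * ‖(x j - x i) - (y j - y i)‖ ^ 2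

/-- The Lennard-Jones potential of the tree is of the squared-distance form used above:
`lennardJones r = W (r^2)` with `W s = (1/12) (s⁻¹)^6 - (1/6) (s⁻¹)^3`. -/
theorem lennardJones_eq_sq (r : ℝ) :
    lennardJones r = (1 / 12) * ((r ^ 2)⁻¹) ^ 6 - (1 / 6) * ((r ^ 2)⁻¹) ^ 3 := by
  unfold lennardJones
  rw [inv_pow, inv_pow, inv_pow, inv_pow, ← pow_mul, ← pow_mul]

end Summit.AtomisticToContinuum.Crystallization.Cruxes.DefectFreeCrystallizes

end
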